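import Literature.NumberTheory.Automorphic.UnitIdeleArchPushforward
import Literature.NumberTheory.Automorphic.RankinSelbergTorusIntegral
import Literature.NumberTheory.Automorphic.GLnMaximalCompactCompact
import Literature.NumberTheory.Automorphic.AdelicVectorHeightCompact
import Literature.MeasureTheory.Group.UnitsHaarDensity
import HarnessLib

/-!
# The archimedean coordinates of the unit torus and of the maximal compact subgroup carry Haar measures

Topic `NumberTheory/Automorphic`; namespace `Literature.NumberTheory.Automorphic`. Measure-theoretic
groundwork for the archimedean half of the reduction of the named fact
`JacquetShalika1981_partialPairL_pole_of_eq_conj` (`PairLFunctionPoles`; Arthur–Clozel (1989), Ch. 3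
(2.3)) in every rank. After the finite places have been disposed of (`TorusIntegrandThinSupport`), the
`S'`-part of the unfolded Rankin–Selberg integral is an integral over `B(all finite places) × K`,
`B(all finite places) = 𝕌_Kⁿ ≤ (𝔸_Kˣ)ⁿ` the `n`-tuples of unit ideles and `K = K_∞ GL_n(𝒪̂_K)`, of a
function of the ARCHIMEDEAN coordinates `(a_∞, k_∞) ∈ (K_∞ˣ)ⁿ × K_∞` only. This file pushes the measures
forward:

* `archTorusOfIdele n K : (𝔸_Kˣ)ⁿ →* (K_∞ˣ)ⁿ` (`archUnitsOfIdele` componentwise) and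
  `kinfOfMaximalCompact n K : K →* K_∞` (`GLn.toMixed`, `toMixed_mem_Kinf_of_mem_standardMaximalCompactGL`);
* `isHaarMeasure_map_archTorusOfIdele` — the image of `νA|_{𝕌_Kⁿ}` (a Haar measure `νA` on `(𝔸_Kˣ)ⁿ`
  restricted to the open subgroup `𝕌_Kⁿ`) is a Haar measure on `(K_∞ˣ)ⁿ`: left invariant (lift
  `x ↦ (x, 1) ∈ 𝕌_K`, `infiniteIdeleOfMixed`), finite on compacts (the sizes `‖a_w‖^{±1}` are bounded on
  compacts, `isCompact_setOf_mem_unitIdeles_norm_le`) and positive on non-empty open sets — the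
  `n`-fold form of `exists_setLIntegral_unitIdeles_eq_mul_lintegral_mixedUnits` (Tate (1967), §4.3);
* `isHaarMeasure_map_kinfOfMaximalCompact` — the image of a Haar measure of the compact group `K`
  is a Haar measure on `K_∞`;
* `setLIntegral_unitBox_univ_prod_eq_lintegral_map` — **the change of variables**
  `∫⁻_{𝕌_Kⁿ × K} F(a_∞, k_∞) d(νA × νK) = ∫⁻ F d((νA|.map Θ) × (νK.map π))`.

All proofs complete; no named fact.

## References

* J. Tate, *Fourier analysis in number fields and Hecke's zeta-functions*, in Cassels–Fröhlich (1967),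
  Ch. XV §4.3 [CasselsFrohlichANT1967].
* R. Godement, H. Jacquet, *Zeta functions of simple algebras*, LNM 260 (1972), §10–§11 (the
  decomposition `g = g_∞ g_f`, integration over `K`) [GodementJacquetLNM260].
-/

noncomputable section

open MeasureTheory Measure NumberField NumberField.mixedEmbedding IsDedekindDomain Set Filter Topology
open Literature.NumberTheory.GaloisRepresentations (ideleGroup unitIdeles infiniteIdeles isOpen_unitIdeles
  mem_unitIdeles_iff)
open scoped ENNReal NNReal Pointwise Classical

namespace Literature.NumberTheory.Automorphic

section Maps

variable (n : ℕ) (K : Type) [Field K] [NumberField K]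

/-- **The archimedean coordinates of a torus element**: `(𝔸_Kˣ)ⁿ →* (K_∞ˣ)ⁿ`, `a ↦ (a_{i,∞})ᵢ`
(`archUnitsOfIdele` componentwise). [folklore] -/
def archTorusOfIdele : (Fin n → ideleGroup K) →* (Fin n → (mixedSpace K)ˣ) where
  toFun a i := archUnitsOfIdele K (a i)
  map_one' := funext fun i => by rw [Pi.one_apply, map_one, Pi.one_apply]
  map_mul' a b := funext fun i => by rw [Pi.mul_apply, map_mul, Pi.mul_apply]

/-- **The archimedean component of the maximal compact subgroup**: `K = K_∞ GL_n(𝒪̂_K) →* K_∞`,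
`k ↦ k_∞`. [folklore] -/
def kinfOfMaximalCompact : ↥(maximalCompactAdelic n K) →* ↥(Kinf n K) :=
  ((GLn.toMixed n K).comp (maximalCompactAdelic n K).subtype).codRestrict (Kinf n K)
    fun k => toMixed_mem_Kinf_of_mem_standardMaximalCompactGL k.2

variable {n K}

/-- Unfolding of `archTorusOfIdele`. [folklore] -/
@[simp]
theorem archTorusOfIdele_apply (a : Fin n → ideleGroup K) (i : Fin n) :
    archTorusOfIdele n K a i = archUnitsOfIdele K (a i) := rfl

/-- Unfolding of `kinfOfMaximalCompact`. [folklore] -/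
@[simp]
theorem coe_kinfOfMaximalCompact (k : ↥(maximalCompactAdelic n K)) :
    ((kinfOfMaximalCompact n K k : ↥(Kinf n K)) : GL (Fin n) (mixedSpace K)) =
      GLn.toMixed n K (k : (AdelicGroupData.gl n K).Adelic) := rfl

/-- `archTorusOfIdele` is continuous. [folklore] -/
theorem continuous_archTorusOfIdele : Continuous (archTorusOfIdele n K) :=
  continuous_pi fun i => continuous_archUnitsOfIdele.comp (continuous_apply i)

/-- `kinfOfMaximalCompact` is continuous. [folklore] -/
theorem continuous_kinfOfMaximalCompact : Continuous (kinfOfMaximalCompact n K) :=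
  ((GLn.continuous_toMixed n K).comp continuous_subtype_val).subtype_mk _

/-- **The lift `(x, 1)` of `x ∈ (K_∞ˣ)ⁿ`** to a tuple of unit ideles. [folklore] -/
def infiniteTorusOfMixed (x : Fin n → (mixedSpace K)ˣ) : Fin n → ideleGroup K := fun i => infiniteIdeleOfMixed (x i)

/-- The lift has unit entries. [folklore] -/
theorem infiniteTorusOfMixed_mem_unitBox (x : Fin n → (mixedSpace K)ˣ) :
    infiniteTorusOfMixed x ∈ unitBox (n := n) (K := K) (Set.univ : Set (HeightOneSpectrum (𝓞 K))) :=
  fun w _ i => mem_unitIdeles_iff.1 (infiniteIdeleOfMixed_mem_unitIdeles (x i)) w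

/-- The archimedean coordinates of the lift. [folklore] -/
theorem archTorusOfIdele_infiniteTorusOfMixed (x : Fin n → (mixedSpace K)ˣ) :
    archTorusOfIdele n K (infiniteTorusOfMixed x) = x :=
  funext fun i => archUnitsOfIdele_infiniteIdeleOfMixed (x i)

/-- **`B(all finite places) = 𝕌_Kⁿ`**: the unit box off every finite place is the box of unit ideles. [folklore] -/
theorem unitBox_univ_eq_pi :
    unitBox (n := n) (K := K) (Set.univ : Set (HeightOneSpectrum (𝓞 K))) =
      Set.pi Set.univ fun _ => (unitIdeles K : Set (ideleGroup K)) := by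
  ext a
  simp only [Set.mem_univ_pi, SetLike.mem_coe, mem_unitIdeles_iff]
  exact ⟨fun h i w => h w (Set.mem_univ w) i, fun h w _ i => h i w⟩

/-- The unit box off every finite place is open. [folklore] -/
theorem isOpen_unitBox_univ :
    IsOpen (unitBox (n := n) (K := K) (Set.univ : Set (HeightOneSpectrum (𝓞 K)))) := by
  rw [unitBox_univ_eq_pi]
  exact isOpen_set_pi Set.finite_univ fun _ _ => isOpen_unitIdeles K

/-- The unit box off every finite place is a subgroup (as a set: closed under multiplication). [folklore] -/
theorem mul_mem_unitBox_univ {a b : Fin n → ideleGroup K}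
    (ha : a ∈ unitBox (n := n) (K := K) (Set.univ : Set (HeightOneSpectrum (𝓞 K))))
    (hb : b ∈ unitBox (n := n) (K := K) (Set.univ : Set (HeightOneSpectrum (𝓞 K)))) :
    a * b ∈ unitBox (n := n) (K := K) (Set.univ : Set (HeightOneSpectrum (𝓞 K))) := by
  rw [unitBox_univ_eq_pi, Set.mem_univ_pi] at ha hb ⊢
  exact fun i => (unitIdeles K).mul_mem (ha i) (hb i)

/-- Inverses stay in the unit box off every finite place. [folklore] -/
theorem inv_mem_unitBox_univ {a : Fin n → ideleGroup K}
    (ha : a ∈ unitBox (n := n) (K := K) (Set.univ : Set (HeightOneSpectrum (𝓞 K)))) :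
    a⁻¹ ∈ unitBox (n := n) (K := K) (Set.univ : Set (HeightOneSpectrum (𝓞 K))) := by
  rw [unitBox_univ_eq_pi, Set.mem_univ_pi] at ha ⊢
  exact fun i => (unitIdeles K).inv_mem (ha i)

/-- **The lift `(κ, 1)` of `κ ∈ K_∞`** to the maximal compact subgroup. [folklore] -/
def maximalCompactOfKinf (κ : ↥(Kinf n K)) : ↥(maximalCompactAdelic n K) :=
  ⟨GLn.ofInfinite n K (κ : GL (Fin n) (mixedSpace K)), by
    have h : GLn.ofInfinite n K (κ : GL (Fin n) (mixedSpace K)) * 1 ∈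
        (standardMaximalCompactGL n K : Set (GL (Fin n) (AdeleRing (𝓞 K) K))) := by
      rw [coe_standardMaximalCompactGL_eq_mul]
      exact Set.mul_mem_mul ⟨(κ : GL (Fin n) (mixedSpace K)), κ.2, rfl⟩ (glIntegralLevel n K).one_mem
    rw [mul_one] at h
    exact h⟩

/-- The archimedean component of the lift. [folklore] -/
theorem kinfOfMaximalCompact_maximalCompactOfKinf (κ : ↥(Kinf n K)) :
    kinfOfMaximalCompact n K (maximalCompactOfKinf κ) = κ :=
  Subtype.ext (GLn.toMixed_ofInfinite _)

/-- `kinfOfMaximalCompact` is surjective. [folklore] -/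
theorem kinfOfMaximalCompact_surjective : Function.Surjective (kinfOfMaximalCompact n K) :=
  fun κ => ⟨maximalCompactOfKinf κ, kinfOfMaximalCompact_maximalCompactOfKinf κ⟩

end Maps

/-! ### The image measures are Haar measures -/

section Haar

variable {n : ℕ} {K : Type} [Field K] [NumberField K]

attribute [local instance] Literature.MeasureTheory.Group.hasSummableGeomSeries_of_finiteDimensional
  Literature.MeasureTheory.Group.Units.borelSpace_of_isOpenEmbedding
  Literature.MeasureTheory.Group.Units.secondCountableTopology
  Literature.MeasureTheory.Group.Units.locallyCompactSpace

/-- The Borel structure of `(K_∞ˣ)ⁿ` (Mathlib's `Units.instMeasurableSpace` on each factor is Borel,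
`Units.borelSpace_of_isOpenEmbedding`; countable products of second countable Borel spaces). [folklore] -/
theorem borelSpace_pi_mixedUnits : BorelSpace (Fin n → (mixedSpace K)ˣ) := by
  haveI hB : BorelSpace ((mixedSpace K)ˣ) := inferInstance
  haveI hS : SecondCountableTopology ((mixedSpace K)ˣ) := inferInstance
  exact @Pi.borelSpace (Fin n) (fun _ => (mixedSpace K)ˣ) _ _ _ (fun _ => hS) (fun _ => hB)

/-- Multiplication on `(K_∞ˣ)ⁿ` is measurable. [folklore] -/
theorem measurableMul_pi_mixedUnits : MeasurableMul (Fin n → (mixedSpace K)ˣ) := by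
  haveI := borelSpace_pi_mixedUnits (n := n) (K := K)
  exact ContinuousMul.measurableMul

variable [MeasurableSpace (ideleGroup K)] [BorelSpace (ideleGroup K)]
  [MeasurableSpace (GL (Fin n) (mixedSpace K))] [BorelSpace (GL (Fin n) (mixedSpace K))]

attribute [local instance] secondCountableTopology_ideleGroup borelSpace_pi_mixedUnits measurableMul_pi_mixedUnits

omit [MeasurableSpace (GL (Fin n) (mixedSpace K))] [BorelSpace (GL (Fin n) (mixedSpace K))] in
/-- **The image of `νA|_{𝕌_Kⁿ}` under the archimedean coordinates is a Haar measure on `(K_∞ˣ)ⁿ`.**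
[folklore] -/
theorem isHaarMeasure_map_archTorusOfIdele (νA : Measure (Fin n → ideleGroup K)) [IsHaarMeasure νA] :
    IsHaarMeasure (((νA.restrict (unitBox (Set.univ : Set (HeightOneSpectrum (𝓞 K))))).map
      (archTorusOfIdele n K)) : Measure (Fin n → (mixedSpace K)ˣ)) := by
  set U : Set (Fin n → ideleGroup K) := unitBox (Set.univ : Set (HeightOneSpectrum (𝓞 K))) with hU
  have hUo : IsOpen U := isOpen_unitBox_univ
  have hUm : MeasurableSet U := hUo.measurableSet
  set Θ : (Fin n → ideleGroup K) → (Fin n → (mixedSpace K)ˣ) := ⇑(archTorusOfIdele n K) with hΘ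
  have hΘc : Continuous Θ := continuous_archTorusOfIdele
  have hΘm : Measurable Θ := hΘc.measurable
  set ρ : Measure (Fin n → (mixedSpace K)ˣ) := (νA.restrict U).map Θ with hρ
  -- left invariance
  have hinv : ρ.IsMulLeftInvariant := by
    refine ⟨fun x => ?_⟩
    set t : Fin n → ideleGroup K := infiniteTorusOfMixed x with ht
    have htU : t ∈ U := infiniteTorusOfMixed_mem_unitBox x
    have hΘt : ∀ a, Θ (t * a) = x * Θ a := by
      intro a
      change archTorusOfIdele n K (t * a) = x * archTorusOfIdele n K a
      rw [map_mul, ht, archTorusOfIdele_infiniteTorusOfMixed]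
    have hcomp : ((fun z => x * z) ∘ Θ) = Θ ∘ fun a => t * a := by
      funext a; simp only [Function.comp_apply, hΘt]
    have hpre : (fun a => t * a) ⁻¹' U = U := by
      ext a
      simp only [Set.mem_preimage]
      refine ⟨fun h => ?_, fun h => mul_mem_unitBox_univ htU h⟩
      have := mul_mem_unitBox_univ (inv_mem_unitBox_univ htU) h
      rwa [inv_mul_cancel_left] at this
    rw [hρ, Measure.map_map (measurable_const_mul x) hΘm, hcomp, ← Measure.map_map hΘm (measurable_const_mul t)]
    congr 1
    conv_lhs => rw [← hpre]
    rw [← Measure.restrict_map (measurable_const_mul t) hUm, map_mul_left_eq_self]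
  -- finite on compacts
  have hfin : IsFiniteMeasureOnCompacts ρ := by
    refine ⟨fun C hC => ?_⟩
    have hcont : ∀ w : InfinitePlace K, Continuous fun z : (mixedSpace K)ˣ =>
        ‖(InfiniteAdeleRing.ringEquiv_mixedSpace K).symm (z : mixedSpace K) w‖ := fun w =>
      (continuous_apply w |>.comp ((continuous_ringEquiv_mixedSpace_symm K).comp Units.continuous_val)).norm
    have hcont' : ∀ w : InfinitePlace K, Continuous fun z : (mixedSpace K)ˣ =>
        ‖(InfiniteAdeleRing.ringEquiv_mixedSpace K).symm ((z⁻¹ : (mixedSpace K)ˣ) : mixedSpace K) w‖ := fun w =>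
      (hcont w).comp continuous_inv
    -- a bound for all coordinates at once
    have hf : Continuous fun x : Fin n → (mixedSpace K)ˣ => ∑ i : Fin n, ∑ w : InfinitePlace K,
        (‖(InfiniteAdeleRing.ringEquiv_mixedSpace K).symm ((x i : (mixedSpace K)ˣ) : mixedSpace K) w‖ +
          ‖(InfiniteAdeleRing.ringEquiv_mixedSpace K).symm (((x i)⁻¹ : (mixedSpace K)ˣ) : mixedSpace K) w‖) :=
      continuous_finsetSum _ fun i _ => continuous_finsetSum _ fun w _ =>
        ((hcont w).comp (continuous_apply i)).add ((hcont' w).comp (continuous_apply i))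
    obtain ⟨R, hR⟩ := hC.exists_bound_of_continuousOn hf.continuousOn
    have hRi : ∀ x ∈ C, ∀ i w,
        ‖(InfiniteAdeleRing.ringEquiv_mixedSpace K).symm ((x i : (mixedSpace K)ˣ) : mixedSpace K) w‖ ≤ R ∧
        ‖(InfiniteAdeleRing.ringEquiv_mixedSpace K).symm (((x i)⁻¹ : (mixedSpace K)ˣ) : mixedSpace K) w‖ ≤ R := by
      intro x hx i w
      have h := hR x hx
      rw [Real.norm_eq_abs, abs_of_nonneg (Finset.sum_nonneg fun i _ => Finset.sum_nonneg fun w _ =>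
        add_nonneg (norm_nonneg _) (norm_nonneg _))] at h
      have hi := Finset.single_le_sum (f := fun i : Fin n => ∑ w : InfinitePlace K,
          (‖(InfiniteAdeleRing.ringEquiv_mixedSpace K).symm ((x i : (mixedSpace K)ˣ) : mixedSpace K) w‖ +
            ‖(InfiniteAdeleRing.ringEquiv_mixedSpace K).symm (((x i)⁻¹ : (mixedSpace K)ˣ) : mixedSpace K) w‖))
        (fun i _ => Finset.sum_nonneg fun w _ => add_nonneg (norm_nonneg _) (norm_nonneg _)) (Finset.mem_univ i)
      have hw := Finset.single_le_sum (f := fun w : InfinitePlace K =>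
          ‖(InfiniteAdeleRing.ringEquiv_mixedSpace K).symm ((x i : (mixedSpace K)ˣ) : mixedSpace K) w‖ +
            ‖(InfiniteAdeleRing.ringEquiv_mixedSpace K).symm (((x i)⁻¹ : (mixedSpace K)ˣ) : mixedSpace K) w‖)
        (fun w _ => add_nonneg (norm_nonneg _) (norm_nonneg _)) (Finset.mem_univ w)
      have hw' := hw.trans (hi.trans h)
      exact ⟨le_of_add_le_of_nonneg_left hw' (norm_nonneg _), le_of_add_le_of_nonneg_right hw' (norm_nonneg _)⟩
    rw [hρ, Measure.map_apply hΘm hC.measurableSet, Measure.restrict_apply (hΘm hC.measurableSet)]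
    set S₁ : Set (ideleGroup K) := {x : ideleGroup K | x ∈ unitIdeles K ∧
      ∀ w : InfinitePlace K, ‖((x : ideleGroup K) : AdeleRing (𝓞 K) K).1 w‖ ≤ R ∧
        ‖((x⁻¹ : ideleGroup K) : AdeleRing (𝓞 K) K).1 w‖ ≤ R} with hS₁
    have hS₁c : IsCompact S₁ := isCompact_setOf_mem_unitIdeles_norm_le R R
    set S : Set (Fin n → ideleGroup K) := Set.pi Set.univ fun _ => S₁ with hS
    have hSc : IsCompact S := isCompact_univ_pi fun _ => hS₁c
    have hsub : Θ ⁻¹' C ∩ U ⊆ S := by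
      rintro a ⟨haC, haU⟩
      rw [hS, Set.mem_univ_pi]
      intro i
      rw [hU, unitBox_univ_eq_pi, Set.mem_univ_pi] at haU
      refine ⟨haU i, fun w => ?_⟩
      obtain ⟨h1, h2⟩ := hRi (Θ a) haC i w
      constructor
      · rw [norm_fst_eq_of_archUnitsOfIdele]; exact h1
      · rw [norm_fst_eq_of_archUnitsOfIdele, map_inv]; exact h2
    exact (measure_mono hsub).trans_lt hSc.measure_lt_top
  -- positive on non-empty open sets
  have hpos : ρ.IsOpenPosMeasure := by
    refine ⟨fun O hO hne => ?_⟩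
    obtain ⟨x, hx⟩ := hne
    rw [hρ, Measure.map_apply hΘm hO.measurableSet, Measure.restrict_apply (hΘm hO.measurableSet)]
    have ho : IsOpen (Θ ⁻¹' O ∩ U) := (hO.preimage hΘc).inter hUo
    have hxO : Θ (infiniteTorusOfMixed x) ∈ O := by
      change archTorusOfIdele n K (infiniteTorusOfMixed x) ∈ O
      rwa [archTorusOfIdele_infiniteTorusOfMixed]
    have hne' : (Θ ⁻¹' O ∩ U).Nonempty := ⟨infiniteTorusOfMixed x, hxO, infiniteTorusOfMixed_mem_unitBox x⟩
    exact (ho.measure_pos νA hne').ne'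
  haveI := hinv
  haveI := hfin
  haveI := hpos
  exact IsHaarMeasure.mk

variable [MeasurableSpace (AdelicGroupData.gl n K).Adelic] [BorelSpace (AdelicGroupData.gl n K).Adelic]

omit [MeasurableSpace (ideleGroup K)] [BorelSpace (ideleGroup K)] in
/-- **The image of a Haar measure of `K` under the archimedean component is a Haar measure on `K_∞`.**
[folklore] -/
theorem isHaarMeasure_map_kinfOfMaximalCompact (νK : Measure ↥(maximalCompactAdelic n K)) [IsHaarMeasure νK] :
    IsHaarMeasure ((νK.map (kinfOfMaximalCompact n K)) : Measure ↥(Kinf n K)) := by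
  haveI : CompactSpace ↥(maximalCompactAdelic n K) :=
    isCompact_iff_compactSpace.1 (isCompact_maximalCompactAdelic n K)
  set π : ↥(maximalCompactAdelic n K) → ↥(Kinf n K) := ⇑(kinfOfMaximalCompact n K) with hπ
  have hπc : Continuous π := continuous_kinfOfMaximalCompact
  have hπm : Measurable π := hπc.measurable
  set ρ : Measure ↥(Kinf n K) := νK.map π with hρ
  have hinv : ρ.IsMulLeftInvariant := by
    refine ⟨fun κ => ?_⟩
    set t : ↥(maximalCompactAdelic n K) := maximalCompactOfKinf κ with ht
    have hπt : ∀ k, π (t * k) = κ * π k := by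
      intro k
      change kinfOfMaximalCompact n K (t * k) = κ * kinfOfMaximalCompact n K k
      rw [map_mul, ht, kinfOfMaximalCompact_maximalCompactOfKinf]
    have hcomp : ((fun z => κ * z) ∘ π) = π ∘ fun k => t * k := by
      funext k; simp only [Function.comp_apply, hπt]
    rw [hρ, Measure.map_map (measurable_const_mul κ) hπm, hcomp, ← Measure.map_map hπm (measurable_const_mul t),
      map_mul_left_eq_self]
  haveI : IsFiniteMeasure νK := CompactSpace.isFiniteMeasure
  have hfin : IsFiniteMeasureOnCompacts ρ := by
    haveI : IsFiniteMeasure ρ := Measure.isFiniteMeasure_map νK π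
    infer_instance
  have hpos : ρ.IsOpenPosMeasure := by
    refine ⟨fun O hO hne => ?_⟩
    obtain ⟨x, hx⟩ := hne
    rw [hρ, Measure.map_apply hπm hO.measurableSet]
    obtain ⟨k, hk⟩ := kinfOfMaximalCompact_surjective (n := n) (K := K) x
    have hkO : π k ∈ O := by
      change kinfOfMaximalCompact n K k ∈ O
      rw [hk]
      exact hx
    exact ((hO.preimage hπc).measure_pos νK ⟨k, hkO⟩).ne'
  haveI := hinv
  haveI := hfin
  haveI := hpos
  exact IsHaarMeasure.mk

/-- **The change of variables to the archimedean coordinates.** For measurable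
`F : (K_∞ˣ)ⁿ × K_∞ → [0, ∞]`:
`∫⁻_{B(all finite places) × K} F(a_∞, k_∞) d(νA × νK) = ∫⁻ F d((νA|_{𝕌ⁿ}.map Θ) × (νK.map π))`.
[folklore] -/
theorem setLIntegral_unitBox_univ_prod_eq_lintegral_map (νA : Measure (Fin n → ideleGroup K)) [SFinite νA]
    (νK : Measure ↥(maximalCompactAdelic n K)) [SFinite νK]
    (F : (Fin n → (mixedSpace K)ˣ) × ↥(Kinf n K) → ℝ≥0∞) (hF : Measurable F) :
    ∫⁻ p in unitBox (Set.univ : Set (HeightOneSpectrum (𝓞 K))) ×ˢ Set.univ,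
        F (archTorusOfIdele n K p.1, kinfOfMaximalCompact n K p.2) ∂(νA.prod νK) =
      ∫⁻ q, F q ∂(((νA.restrict (unitBox (Set.univ : Set (HeightOneSpectrum (𝓞 K))))).map
        (archTorusOfIdele n K)).prod (νK.map (kinfOfMaximalCompact n K))) := by
  have hΘm : Measurable (archTorusOfIdele n K) := continuous_archTorusOfIdele.measurable
  have hπm : Measurable (kinfOfMaximalCompact n K) := continuous_kinfOfMaximalCompact.measurable
  rw [Measure.map_prod_map _ _ hΘm hπm, lintegral_map hF (hΘm.prodMap hπm)]
  have hrestrict : (νA.restrict (unitBox (Set.univ : Set (HeightOneSpectrum (𝓞 K))))).prod νK =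
      (νA.prod νK).restrict (unitBox (Set.univ : Set (HeightOneSpectrum (𝓞 K))) ×ˢ Set.univ) := by
    conv_lhs => rw [← Measure.restrict_univ (μ := νK)]
    rw [Measure.prod_restrict]
  rw [hrestrict]
  rfl

end Haar

end Literature.NumberTheory.Automorphic
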